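import Summits.BirchSwinnertonDyer.BirchSwinnertonDyer.Theorems.ManinLocalTwoThreePinningKernel
import Summits.BirchSwinnertonDyer.BirchSwinnertonDyer.Theorems.ManinLocalTwoThreeEtaFrickeLaw
import Summits.BirchSwinnertonDyer.BirchSwinnertonDyer.Theorems.ManinLocalTwoThreeCurveSideFiftyTwo
import HarnessLib

/-!
# THE PINNING KERNEL, part C: the FRICKE SIEVE on a `σ`-closed `η`-basis, by integer certificates

Cell `bsd-f2-manin`, route `ManinLocalTwoThree`, cruxes C2 `ManinOddAtFour` (stmt-BirchSwinnertonDyer-22967) and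
C3 `ManinPrimeToThreeAtNine` (stmt-22968); planner seat -an gen 54 (`--supports` helper, turnkey T-an-g54-PKC).
Level-generic; nothing here proves C2, C3, Manin's conjecture or BSD.

Parts A + B pin the newform of an `X₀(N)`-datum to a finite list of certified `η`-combinations; the non-new candidates
(`p`-depleted old classes, e.g. `21a` at level `63`, `26a/26b` at level `52`) pass every curve-side constraint.  This part
removes them by the Fricke involution, generically (the level-52 instance is p1's `…FrickeRowsFiftyTwo` /
`…NewformPinningFiftyTwo`; the abstract sieve `LevelFiftyTwo.fricke_coords` and the `η`-Fricke law
`EtaFricke.etaQuotient_slash_frickeGL` are the tree inputs):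

* §C1 an INTEGER CERTIFICATE for the Fricke constant: `etaFrickeConst N r = num/den` as soon as
  `num² · ∏_{r_δ>0} δ^{r_δ} = N² · den² · ∏_{r_δ<0} δ^{−r_δ}` (`etaFrickeConst_eq_of_natCert`, decidable premise);
* §C2 on a `σ`-CLOSED certified `η`-family (`frickeExp N rᵢ = r_{σ i}` on the divisors, decidable) `w_N` is a signed scalar
  permutation: `⇑(C i) ∣₂ w_N = −(numᵢ/denᵢ) • ⇑(C (σ i))` (`slash_eq_of_frickeCert`);
* §C3 THE FRICKE ROWS of a pinned newform: if `d' • D.f = Σ_j y_j • C_j` (part B) with `σ` injective, then for the sign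
  `ε = ε(D.f) ∈ {±1}`: `ε · y_{σ i} · denᵢ = −numᵢ · yᵢ` for every `i` (`frickeRows_of_pinning`) — a decidable
  condition on `y`, so a candidate failing it for both signs is impossible (`exists_smul_eq_sum_of_frickeCerts`).
[cite: AtkinLehner1970, Thm. 3] [cite: Koehler2011, §2.4] [cite: CremonaAlgorithms1997, §2.10]
-/

set_option autoImplicit false
-- lint-debt: the directory name repeats the summit name (sibling precedent `ManinLocalTwoThreeNewformPinningFiftySix.lean`)
set_option linter.dupNamespace false

noncomputable section

open Complex
open UpperHalfPlane hiding I
open scoped MatrixGroups ModularForm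
open ModularForm CongruenceSubgroup
open Literature.NumberTheory.ModularForms
open Literature.NumberTheory.EllipticCurves Literature.NumberTheory.EllipticCurves.ModularForms

namespace Summit.BirchSwinnertonDyer.BirchSwinnertonDyer.Theorems.ManinLocalTwoThree.PinningKernel

open Summit.BirchSwinnertonDyer.BirchSwinnertonDyer.Theorems.ManinLocalTwoThree.EtaFricke
open Summit.BirchSwinnertonDyer.BirchSwinnertonDyer.Theorems.ManinLocalTwoThree.LevelFiftyTwo (fricke_coords)

/-! ## §C1 An integer certificate for the Fricke constant -/

section Const

variable (N : ℕ) [NeZero N]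

/-- `∏_{δ ∣ N, r_δ > 0} δ^{r_δ}`. [folklore] -/
def posPart (r : ℕ → ℤ) : ℕ := ∏ δ ∈ N.divisors, δ ^ (r δ).toNat

/-- `∏_{δ ∣ N, r_δ < 0} δ^{−r_δ}`. [folklore] -/
def negPart (r : ℕ → ℤ) : ℕ := ∏ δ ∈ N.divisors, δ ^ (-r δ).toNat

omit [NeZero N] in
/-- `∏_δ δ^{r_δ} = posPart / negPart` over `ℝ`. [folklore] -/
theorem prod_zpow_eq_div (r : ℕ → ℤ) :
    ∏ δ ∈ N.divisors, (δ : ℝ) ^ r δ = (posPart N r : ℝ) / (negPart N r : ℝ) := by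
  rw [posPart, negPart, Nat.cast_prod, Nat.cast_prod, ← Finset.prod_div_distrib]
  refine Finset.prod_congr rfl fun δ hδ ↦ ?_
  have hδ0 : (δ : ℝ) ≠ 0 := by exact_mod_cast (Nat.pos_of_mem_divisors hδ).ne'
  rw [Nat.cast_pow, Nat.cast_pow, ← zpow_natCast, ← zpow_natCast, ← zpow_sub₀ hδ0]
  congr 1
  omega

/-- **Integer certificate for the Fricke constant**: `K = num/den` if `num²·posPart = N²·den²·negPart` (decidable).
[cite: Koehler2011, §2.4] -/
theorem etaFrickeConst_eq_of_natCert (r : ℕ → ℤ) (hr : ∑ δ ∈ N.divisors, r δ = 4) (num den : ℕ)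
    (hnum : 0 < num) (hden : 0 < den) (h : num ^ 2 * posPart N r = N ^ 2 * den ^ 2 * negPart N r) :
    etaFrickeConst N r = (num : ℝ) / den := by
  have hneg : (0 : ℝ) < negPart N r := by
    rw [negPart, Nat.cast_pos]
    exact Finset.prod_pos fun δ hδ ↦ pow_pos (Nat.pos_of_mem_divisors hδ) _
  refine etaFrickeConst_eq_of_sq N r hr (div_pos (by exact_mod_cast hnum) (by exact_mod_cast hden)) ?_
  rw [prod_zpow_eq_div, div_pow, div_mul_div_comm, div_eq_iff (mul_pos (pow_pos (by exact_mod_cast hden) 2) hneg).ne',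
    ← mul_assoc]
  exact_mod_cast h

omit [NeZero N] in
/-- `η`-quotients only depend on the exponents at the divisors of `N`. [folklore] -/
theorem etaQuotient_congr {r r' : ℕ → ℤ} (h : ∀ δ ∈ N.divisors, r δ = r' δ) :
    etaQuotient N r = etaQuotient N r' := by
  funext τ
  rw [etaQuotient_apply, etaQuotient_apply]
  exact Finset.prod_congr rfl fun δ hδ ↦ by rw [h δ hδ]

end Const

/-! ## §C2 `w_N` on a `σ`-closed certified `η`-family -/

section Sigma

variable {N : ℕ} [NeZero N] {g : ℕ} (C : Fin g → ModularForm (Gamma0 N) 2) (r : Fin g → ℕ → ℤ)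
  (hC : ∀ i, ∀ τ : ℍ, C i τ = etaQuotient N (r i) τ) (sig : Fin g → Fin g) (num den : Fin g → ℕ)
  (hsum : ∀ i, ∑ δ ∈ N.divisors, r i δ = 4)
  (hsig : ∀ i, ∀ δ ∈ N.divisors, frickeExp N (r i) δ = r (sig i) δ)
  (hK : ∀ i, 0 < num i ∧ 0 < den i ∧ num i ^ 2 * posPart N (r i) = N ^ 2 * den i ^ 2 * negPart N (r i))

include hC hsum hsig hK in
/-- **`w_N` is a signed scalar permutation on a `σ`-closed certified `η`-family**:
`⇑(C i) ∣₂ w_N = −(numᵢ/denᵢ) • ⇑(C (σ i))`. [cite: AtkinLehner1970, Thm. 3] [cite: Koehler2011, §2.4] -/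
theorem slash_eq_of_frickeCert (i : Fin g) :
    (⇑(C i) : ℍ → ℂ) ∣[(2 : ℤ)] (glCast (frickeGL N : GL (Fin 2) ℚ) : GL (Fin 2) ℝ) =
      (-(((num i : ℝ) / den i : ℝ) : ℂ)) • (⇑(C (sig i)) : ℍ → ℂ) := by
  obtain ⟨hn, hd, hcert⟩ := hK i
  rw [show (⇑(C i) : ℍ → ℂ) = etaQuotient N (r i) from funext (hC i),
    show (⇑(C (sig i)) : ℍ → ℂ) = etaQuotient N (r (sig i)) from funext (hC (sig i)),
    etaQuotient_slash_frickeGL N (r i) (hsum i), etaFrickeConst_eq_of_natCert N (r i) (hsum i) (num i) (den i) hn hd hcert,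
    etaQuotient_congr N (hsig i)]

/-- The matrix of `w_N`: `Φ j i = −numᵢ/denᵢ` if `j = σ i`, else `0`. [folklore] -/
def frickePhi : Fin g → Fin g → ℂ := fun j i ↦ if sig i = j then -(((num i : ℝ) / den i : ℝ) : ℂ) else 0

include hC hsum hsig hK in
/-- Matrix form of `slash_eq_of_frickeCert`. [folklore] -/
theorem slash_eq_sum_frickePhi (i : Fin g) :
    (⇑(C i) : ℍ → ℂ) ∣[(2 : ℤ)] (glCast (frickeGL N : GL (Fin 2) ℚ) : GL (Fin 2) ℝ) =
      ∑ j, frickePhi sig num den j i • (⇑(C j) : ℍ → ℂ) := by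
  rw [slash_eq_of_frickeCert C r hC sig num den hsum hsig hK i]
  simp only [frickePhi, ite_smul, zero_smul, Finset.sum_ite_eq, Finset.mem_univ, if_true]

end Sigma

/-! ## §C3 The Fricke rows of a pinned newform; the certified candidate list after the Fricke sieve -/

section Rows

variable {N : ℕ} [NeZero N] {W : WeierstrassCurve ℚ} (D : ModularParametrizationData W N)
  {g : ℕ} (C : Fin g → ModularForm (Gamma0 N) 2) (hli : LinearIndependent ℂ C)
  (sig : Fin g → Fin g) (hinj : Function.Injective sig) (num den : Fin g → ℕ) (hden : ∀ i, 0 < den i)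
  (hW : ∀ i, (⇑(C i) : ℍ → ℂ) ∣[(2 : ℤ)] (glCast (frickeGL N : GL (Fin 2) ℚ) : GL (Fin 2) ℝ) =
      ∑ j, frickePhi sig num den j i • (⇑(C j) : ℍ → ℂ))

omit [NeZero N] in
/-- Coercion of a combination in `M₂(Γ₀(N))` to functions. [folklore] -/
theorem coe_sum_smul (c : Fin g → ℂ) :
    (⇑(∑ i, c i • C i) : ℍ → ℂ) = ∑ i, c i • (⇑(C i) : ℍ → ℂ) := by
  change ModularForm.coeHom (∑ i, c i • C i) = ∑ i, c i • (⇑(C i) : ℍ → ℂ)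
  rw [map_sum]
  exact Finset.sum_congr rfl fun i _ ↦ rfl

omit [NeZero N] in
include hli in
/-- Independence in `M₂(Γ₀(N))` gives independence of the underlying functions. [folklore] -/
theorem linearIndependent_coe : LinearIndependent ℂ (fun i ↦ (⇑(C i) : ℍ → ℂ)) := by
  rw [Fintype.linearIndependent_iff]
  intro x hx
  have h0 : (∑ i, x i • C i : ModularForm (Gamma0 N) 2) = 0 := by
    apply DFunLike.coe_injective
    rw [coe_sum_smul]
    simpa using hx
  exact Fintype.linearIndependent_iff.mp hli x h0

/-- The decidable Fricke-row check on integer coordinates: `ε·y_{σ i}·denᵢ = −numᵢ·yᵢ` for all `i`. [folklore] -/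
def frickeRowsOK (sig : Fin g → Fin g) (num den : Fin g → ℕ) (ε : ℤ) (ys : List ℤ) : Bool :=
  decide (∀ i : Fin g, ε * ys.getD (sig i : ℕ) 0 * den i = -(num i * ys.getD (i : ℕ) 0))

include hli hinj hden hW in
/-- **THE FRICKE ROWS OF A PINNED NEWFORM.**  If `d' • D.f = Σ_j y_j • C_j` in `M₂(Γ₀(N))` (`d' ≠ 0`), then the
integer coordinates pass the Fricke-row check for `ε = 1` or for `ε = −1`. [cite: AtkinLehner1970, Thm. 3] -/
theorem frickeRows_of_pinning {d' : ℤ} (hd' : d' ≠ 0) (ys : List ℤ)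
    (hpin : ((d' : ℤ) : ℂ) • ModularFormClass.modularForm D.f = ∑ j : Fin g, ((ys.getD (j : ℕ) 0 : ℤ) : ℂ) • C j) :
    frickeRowsOK sig num den 1 ys = true ∨ frickeRowsOK sig num den (-1) ys = true := by
  set x : Fin g → ℂ := fun j ↦ ((ys.getD (j : ℕ) 0 : ℤ) : ℂ) / d' with hx
  have hd'C : ((d' : ℤ) : ℂ) ≠ 0 := Int.cast_ne_zero.mpr hd'
  have hf : (⇑D.f : ℍ → ℂ) = ∑ i, x i • (⇑(C i) : ℍ → ℂ) := by
    have h1 : (ModularFormClass.modularForm D.f : ModularForm (Gamma0 N) 2) = ∑ j, x j • C j := by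
      have h2 := congrArg (fun G : ModularForm (Gamma0 N) 2 ↦ (((d' : ℤ) : ℂ)⁻¹) • G) hpin
      simp only [smul_smul, inv_mul_cancel₀ hd'C, one_smul, Finset.smul_sum] at h2
      rw [h2]
      exact Finset.sum_congr rfl fun j _ ↦ by rw [hx]; simp only [div_eq_inv_mul]
    have h3 : (⇑D.f : ℍ → ℂ) = ⇑(∑ j, x j • C j : ModularForm (Gamma0 N) 2) := by rw [← h1]; rfl
    rw [h3, coe_sum_smul]
  obtain ⟨ε, hε, hrows⟩ := fricke_coords D (fun i ↦ (⇑(C i) : ℍ → ℂ)) (linearIndependent_coe C hli) x hf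
    (frickePhi sig num den) hW
  -- row `σ i`: `−(numᵢ/denᵢ) x_i = ε x_{σ i}`
  have key : ∀ i, (ε : ℂ) * ys.getD (sig i : ℕ) 0 * den i = -(num i * ys.getD (i : ℕ) 0) := fun i ↦ by
    have h := hrows (sig i)
    rw [Finset.sum_eq_single i (fun j _ hj ↦ by rw [frickePhi, if_neg (fun e ↦ hj (hinj e)), zero_mul])
      (fun h ↦ absurd (Finset.mem_univ i) h)] at h
    have h1 : frickePhi sig num den (sig i) i = -(((num i : ℝ) / den i : ℝ) : ℂ) := by rw [frickePhi, if_pos rfl]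
    have hxσ : x (sig i) = ys.getD (sig i : ℕ) 0 / d' := rfl
    have hxi : x i = ys.getD (i : ℕ) 0 / d' := rfl
    rw [h1, hxi, hxσ, ← mul_div_assoc, ← mul_div_assoc, div_left_inj' hd'C] at h
    have hdi : ((den i : ℕ) : ℂ) ≠ 0 := by exact_mod_cast (hden i).ne'
    have h3 : (((num i : ℝ) / den i : ℝ) : ℂ) * (den i : ℂ) = num i := by push_cast; exact div_mul_cancel₀ _ hdi
    calc (ε : ℂ) * ys.getD (sig i : ℕ) 0 * den i = -(((num i : ℝ) / den i : ℝ) : ℂ) * ys.getD (i : ℕ) 0 * den i := by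
          rw [← h]
      _ = -((((num i : ℝ) / den i : ℝ) : ℂ) * den i) * ys.getD (i : ℕ) 0 := by ring
      _ = -(num i * ys.getD (i : ℕ) 0) := by rw [h3, neg_mul]
  rcases hε with rfl | rfl
  · refine Or.inl (decide_eq_true fun i ↦ ?_)
    have h := key i
    exact_mod_cast h
  · refine Or.inr (decide_eq_true fun i ↦ ?_)
    have h := key i
    exact_mod_cast h

end Rows

end Summit.BirchSwinnertonDyer.BirchSwinnertonDyer.Theorems.ManinLocalTwoThree.PinningKernel

end
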